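import Summits.CriticalPhenomena.CardyFormulaZ2.Theorems.CardyComplexConeEdgePrecompactUFRSRectBoundaryStrandDecayCases
import Literature.Probability.Percolation.AnnulusCrossingBoundProofs

/-!
# One strand away from one of the arcs is a genuine arm of `ω`
(line `qkz-strip-boundary-arm` of crux `CardyComplexCone.EdgePrecompact`, stmt-CriticalPhenomena-11387;
first file of the registered one-strand decay `ufrs_rect_oneStrandDecay` (ONE), the third input of
the landed reduction `ufrs_rectBoundaryStrandDecay_of_bridges`; registered anchor
`ufrs_strand_genuineCrossing`)

A strand of the UFRS programme is a stretch of an orbit of Smirnov's successor map of the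
COMPLETED configuration `β = F.bcBondConfig ω` of a Dobrushin datum `F` (`F = E` or its translate
`shiftData E w`) through inner faces of `F`. Its left walk is `β`-open and its right walk is
`β`-dual (`exists_leftWalk`, `exists_rightWalk`), but `β`-open edges are only `ω`-open OR wired
(both ends on the discrete arc `A`) and `β`-closed domain edges are only `ω`-closed OR touching the
free arc `B` (`mem_bcBondConfig_cases`, `not_mem_bcBondConfig_cases`). This file proves the
deterministic dictionary used by ONE and its probabilistic consequence:

* `strand_genuine_open`, `strand_genuine_dual` — for ANY pair of configurations `β`, `ω`: if along
  the stretch every target edge followed by `β` (resp. crossed by `β`) whose corner has its vertex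
  at distance in `(a - δ, b + δ)` from `z` is `ω`-open (resp. `ω`-closed), then a stretch joining
  the `a`-ball of `z` to distance `≥ b` (either direction) gives `ω ∈ annulusOpenCrossing z δ a b`
  (resp. `ω ∈ annulusDualCrossing z δ (a + 2δ) (b - 2δ)`). Proof: trim the vertex-distance (resp.
  face-distance) sequence to its last visit of the inner ball before its first exit
  (`exists_trimmedStretch`, both directions by reflection), so that every corner of the trimmed
  stretch lies in the band; read the left (resp. right) walk of the trimmed stretch; symmetry of
  `openConnIn` (`openConnIn_comm`) absorbs the direction.
* `ufrs_strand_genuineCrossing` (registered anchor) — for an admissible datum `F` and a stretch of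
  `F.bcBondConfig ω` through inner faces of `F`: if NO site of `F.zdArcA` (or no site of
  `F.zdArcB`) has its mesh point at distance in `(a - 2δ, b + 2δ)` from `z`, the stretch crossing
  `A(z; a, b)` gives a GENUINE open or dual crossing of `ω`.
* `real_ufrsStrands_one_le_of_mono` — hence, under this "monochromatic band" hypothesis for `E` and
  for `shiftData E w`, `P(ufrsStrands E w z 1 a b) ≤ P(open crossing) + P(dual crossing)`, and the
  RSW one-arm bounds `annulusOpenCrossing_half_le_holds` / `annulusDualCrossing_half_le_holds`
  bound the two terms.

References: S. Smirnov, C. R. Acad. Sci. Paris 333 (2001), §2 (exploration, arcs); G. Grimmett,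
*Percolation* (1999), §11.2 (duality), §11.8 (one-arm bound); B. Bollobás, O. Riordan,
*Percolation* (2006), Ch. 7, Lemma 4.
-/

set_option linter.unusedVariables false

namespace Summit.CriticalPhenomena.CardyFormulaZ2.Cruxes.EdgePrecompact.QkzStripBoundaryArm

open MeasureTheory Filter Set Metric
open scoped Topology BigOperators Pointwise
open Literature.Probability.LatticeModels Literature.Probability.Percolation
open Literature.Probability.RandomPlanarGeometry (DobrushinDomain)
open Summit.CriticalPhenomena.CardyFormulaZ2.Theses.CardyComplexCone

noncomputable section

/-! ## Trimming a crossing stretch in either direction -/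

/-- **Two-sided trimming.** A real sequence with steps `≤ δ` joining `(-∞, r]` to `[R, ∞)` on
`[i, j]` in EITHER order has a sub-stretch `[i', j'] ⊆ [i, j]` doing the same (in the same order)
all of whose values lie in `(r - δ, R + δ)` (`exists_trimmedStretch` and its reflection). -/
theorem exists_trimmedStretch' (g : ℕ → ℝ) {δ r R : ℝ} (hrR : r < R)
    (hstep : ∀ t, |g (t + 1) - g t| ≤ δ) {i j : ℕ} (hij : i ≤ j)
    (hends : (g i ≤ r ∧ R ≤ g j) ∨ (R ≤ g i ∧ g j ≤ r)) :
    ∃ i' j', i ≤ i' ∧ i' ≤ j' ∧ j' ≤ j ∧ ((g i' ≤ r ∧ R ≤ g j') ∨ (R ≤ g i' ∧ g j' ≤ r)) ∧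
      ∀ t, i' ≤ t → t ≤ j' → r - δ < g t ∧ g t < R + δ := by
  rcases hends with ⟨hi, hj⟩ | ⟨hi, hj⟩
  · obtain ⟨i', j', h1, h2, h3, h4, h5, h6⟩ := exists_trimmedStretch g hrR hstep hij hi hj
    exact ⟨i', j', h1, h2, h3, Or.inl ⟨h4, h5⟩, h6⟩
  · obtain ⟨i', j', h1, h2, h3, h4, h5, h6⟩ := exists_trimmedStretch (fun t => r + R - g t) hrR
      (fun t => by
        rw [show r + R - g (t + 1) - (r + R - g t) = -(g (t + 1) - g t) by ring, abs_neg]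
        exact hstep t)
      hij (show r + R - g i ≤ r by linarith) (show R ≤ r + R - g j by linarith)
    refine ⟨i', j', h1, h2, h3, Or.inr ⟨by linarith, by linarith⟩, fun t ht htj => ?_⟩
    obtain ⟨h7, h8⟩ := h6 t ht htj
    exact ⟨by linarith, by linarith⟩

/-! ## The genuine open crossing on the left -/

/-- **Genuine open crossing from a strand.** Orbit of `β`, event for `ω`: if every target edge
FOLLOWED by the orbit (`cTgt ∈ β`) at a corner of the stretch whose vertex is at distance in
`(a - δ, b + δ)` from `z` belongs to `ω`, then a stretch `O c [i, j]` joining the `a`-ball of `z`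
to distance `≥ b` (either direction, `a < b`, `0 < δ`) gives `ω ∈ annulusOpenCrossing z δ a b`. -/
theorem strand_genuine_open {β ω : BondConfig (Site 2)} (c : Site 2 × Fin 4) {δ a b : ℝ} (hδ : 0 < δ)
    (hab : a < b) {z : ℂ} {i j : ℕ} (hij : i ≤ j)
    (hends : (dist (meshPoint δ (cornerOrbit β c i).1) z ≤ a ∧ b ≤ dist (meshPoint δ (cornerOrbit β c j).1) z) ∨
      (b ≤ dist (meshPoint δ (cornerOrbit β c i).1) z ∧ dist (meshPoint δ (cornerOrbit β c j).1) z ≤ a))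
    (hgen : ∀ t, i ≤ t → t < j → a - δ < dist (meshPoint δ (cornerOrbit β c t).1) z →
      dist (meshPoint δ (cornerOrbit β c t).1) z < b + δ →
      cTgt (cornerOrbit β c t) ∈ β → cTgt (cornerOrbit β c t) ∈ ω) :
    ω ∈ annulusOpenCrossing z δ a b := by
  set g : ℕ → ℝ := fun t => dist (meshPoint δ (cornerOrbit β c t).1) z with hg
  have hstep : ∀ t, |g (t + 1) - g t| ≤ δ := fun t => by
    have h1 := dist_meshPoint_cornerOrbit_succ_le β c δ t
    rw [abs_of_pos hδ] at h1
    exact (abs_dist_sub_le _ _ z).trans h1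
  obtain ⟨i', j', hii', hi'j', hj'j, hends', hband⟩ := exists_trimmedStretch' g hab hstep hij hends
  obtain ⟨W, hWs, hWe⟩ := exists_leftWalk β c i' j' hi'j'
  have hconn : ω ∈ openConnIn {v : Site 2 | dist (meshPoint δ v) z ≤ b + 2 * δ}
      (cornerOrbit β c i').1 (cornerOrbit β c j').1 := by
    refine mem_openConnIn_of_walk W (fun x hx => ?_) (fun e he => ?_)
    · obtain ⟨t, h1, h2, rfl⟩ := hWs x hx
      have := (hband t h1 h2).2
      show dist (meshPoint δ (cornerOrbit β c t).1) z ≤ b + 2 * δ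
      change g t < b + δ at this
      linarith
    · obtain ⟨t, h1, h2, rfl, hmem⟩ := hWe e he
      obtain ⟨h3, h4⟩ := hband t h1 h2.le
      exact hgen t (hii'.trans h1) (lt_of_lt_of_le h2 hj'j) h3 h4 hmem
  rw [mem_annulusOpenCrossing_iff]
  rcases hends' with ⟨h1, h2⟩ | ⟨h1, h2⟩
  · exact ⟨_, h1, _, h2, hconn⟩
  · rw [openConnIn_comm] at hconn
    exact ⟨_, h2, _, h1, hconn⟩

/-! ## The genuine dual crossing on the right -/

/-- **Genuine dual crossing from a strand.** Orbit of `β`, event for `ω`: if every target edge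
CROSSED by the orbit (`cTgt ∉ β`) at a corner of the stretch whose vertex is at distance in
`(a - δ, b + δ)` from `z` lies outside `ω`, then a stretch `O c [i, j]` joining the `a`-ball of
`z` to distance `≥ b` (either direction, `a + 4δ < b`, `0 < δ`) gives
`ω ∈ annulusDualCrossing z δ (a + 2δ) (b - 2δ)` (read on the right faces, trimmed by the face
distances). -/
theorem strand_genuine_dual {β ω : BondConfig (Site 2)} (c : Site 2 × Fin 4) {δ a b : ℝ} (hδ : 0 < δ)
    (hab : a + 4 * δ < b) {z : ℂ} {i j : ℕ} (hij : i ≤ j)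
    (hends : (dist (meshPoint δ (cornerOrbit β c i).1) z ≤ a ∧ b ≤ dist (meshPoint δ (cornerOrbit β c j).1) z) ∨
      (b ≤ dist (meshPoint δ (cornerOrbit β c i).1) z ∧ dist (meshPoint δ (cornerOrbit β c j).1) z ≤ a))
    (hgen : ∀ t, i ≤ t → t < j → a - δ < dist (meshPoint δ (cornerOrbit β c t).1) z →
      dist (meshPoint δ (cornerOrbit β c t).1) z < b + δ →
      cTgt (cornerOrbit β c t) ∉ β → cTgt (cornerOrbit β c t) ∉ ω) :
    ω ∈ annulusDualCrossing z δ (a + 2 * δ) (b - 2 * δ) := by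
  set f : ℕ → ℝ := fun t => dist (meshPoint δ (cFace (cornerOrbit β c t))) z with hf
  set g : ℕ → ℝ := fun t => dist (meshPoint δ (cornerOrbit β c t).1) z with hg
  have hstep : ∀ t, |f (t + 1) - f t| ≤ δ := fun t => by
    have h1 := dist_meshPoint_cFace_cornerOrbit_succ_le β c δ t
    rw [abs_of_pos hδ] at h1
    exact (abs_dist_sub_le _ _ z).trans h1
  have hfg : ∀ t, |f t - g t| ≤ 2 * δ := fun t =>
    (abs_dist_sub_le _ _ z).trans (dist_meshPoint_cFace_le hδ.le _)
  have hends_f : (f i ≤ a + 2 * δ ∧ b - 2 * δ ≤ f j) ∨ (b - 2 * δ ≤ f i ∧ f j ≤ a + 2 * δ) := by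
    have hi := abs_le.1 (hfg i)
    have hj := abs_le.1 (hfg j)
    rcases hends with ⟨h1, h2⟩ | ⟨h1, h2⟩
    · left
      change g i ≤ a at h1; change b ≤ g j at h2
      constructor <;> linarith
    · right
      change b ≤ g i at h1; change g j ≤ a at h2
      constructor <;> linarith
  obtain ⟨i', j', hii', hi'j', hj'j, hends', hband⟩ :=
    exists_trimmedStretch' f (show a + 2 * δ < b - 2 * δ by linarith) hstep hij hends_f
  obtain ⟨Q, hQs, hQd⟩ := exists_rightWalk β c i' j' hi'j'
  have hconn : dualConfig ω ∈ openConnIn {v : Site 2 | dist (meshPoint δ v) z ≤ b - 2 * δ + 2 * δ}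
      (cFace (cornerOrbit β c i')) (cFace (cornerOrbit β c j')) := by
    refine Z2HalfPlane.dualConfig_mem_openConnIn_of_walk Q (fun x hx => ?_) (fun d hd => ?_)
    · obtain ⟨t, h1, h2, rfl⟩ := hQs x hx
      have := (hband t h1 h2).2
      show dist (meshPoint δ (cFace (cornerOrbit β c t))) z ≤ b - 2 * δ + 2 * δ
      change f t < b - 2 * δ + δ at this
      linarith
    · obtain ⟨t, h1, h2, hsep, hclosed⟩ := hQd d hd
      rw [hsep]
      obtain ⟨h3, h4⟩ := hband t h1 h2.le
      have h5 := abs_le.1 (hfg t)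
      change a + 2 * δ - δ < f t at h3
      change f t < b - 2 * δ + δ at h4
      exact hgen t (hii'.trans h1) (lt_of_lt_of_le h2 hj'j) (by linarith) (by linarith) hclosed
  show dualConfig ω ∈ annulusOpenCrossing z δ (a + 2 * δ) (b - 2 * δ)
  rw [mem_annulusOpenCrossing_iff]
  rcases hends' with ⟨h1, h2⟩ | ⟨h1, h2⟩
  · exact ⟨_, h1, _, h2, hconn⟩
  · rw [openConnIn_comm] at hconn
    exact ⟨_, h2, _, h1, hconn⟩

/-! ## Reading the completed configuration: the registered dictionary -/

/-- The vertex of a corner is an endpoint of its target edge. -/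
theorem fst_mem_cTgt (p : Site 2 × Fin 4) : p.1 ∈ cTgt p := Sym2.mem_mk_left _ _

/-- **One strand away from one of the arcs is a genuine arm of `ω`** (registered anchor
`ufrs_strand_genuineCrossing` of stmt-CriticalPhenomena-11387). For an admissible datum `F`
(mesh `δ = F.δ`), a configuration `ω`, a stretch `O c [i, j]` of the orbit of the completed
configuration `F.bcBondConfig ω` through inner faces of `F`, joining the `a`-ball of `z` to
distance `≥ b` from `z` (either direction, `a + 4δ < b`): if no site of the wired arc `F.zdArcA`
has its mesh point at distance in `(a - 2δ, b + 2δ)` from `z`, or no site of the free arc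
`F.zdArcB` does, then `ω` itself has an open crossing of `A(z; a, b)` or a dual crossing of
`A(z; a + 2δ, b - 2δ)`. Wired edges have both ends on `zdArcA` (`mem_bcBondConfig_cases`), so in
the first case the left walk is `ω`-open; closed domain edges off `ω`-closed ones touch `zdArcB`
(`not_mem_bcBondConfig_cases`, `cTgt_mem_edgeSet_of_isInnerFace`), so in the second case the right
walk crosses `ω`-closed edges only. -/
theorem ufrs_strand_genuineCrossing : ∀ (F : DiscreteDobrushin), F.IsZdAdmissible → ∀ (ω : BondConfig (Site 2)) (c : Site 2 × Fin 4) (i j : ℕ) (z : ℂ) (a b : ℝ), i ≤ j → a + 4 * F.δ < b → ((dist (meshPoint F.δ (cornerOrbit (F.bcBondConfig ω) c i).1) z ≤ a ∧ b ≤ dist (meshPoint F.δ (cornerOrbit (F.bcBondConfig ω) c j).1) z) ∨ (b ≤ dist (meshPoint F.δ (cornerOrbit (F.bcBondConfig ω) c i).1) z ∧ dist (meshPoint F.δ (cornerOrbit (F.bcBondConfig ω) c j).1) z ≤ a)) → (∀ t, i ≤ t → t ≤ j → F.IsInnerFace (cFace (cornerOrbit (F.bcBondConfig ω) c t))) → ((∀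 x ∈ F.zdArcA, dist (meshPoint F.δ x) z ≤ a - 2 * F.δ ∨ b + 2 * F.δ ≤ dist (meshPoint F.δ x) z) ∨ (∀ x ∈ F.zdArcB, dist (meshPoint F.δ x) z ≤ a - 2 * F.δ ∨ b + 2 * F.δ ≤ dist (meshPoint F.δ x) z)) → ω ∈ annulusOpenCrossing z F.δ a b ∨ ω ∈ annulusDualCrossing z F.δ (a + 2 * F.δ) (b - 2 * F.δ) := by
  intro F hF ω c i j z a b hij hab hends hinner hmono
  have hδ : 0 < F.δ := hF.delta_pos
  rcases hmono with hA | hB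
  · left
    refine strand_genuine_open c hδ (by linarith) hij hends fun t h1 h2 hlo hhi hβ => ?_
    obtain ⟨-, hω | hwired, -⟩ := mem_bcBondConfig_cases hF hβ
    · exact hω
    · exfalso
      rcases hA _ (hwired _ (fst_mem_cTgt _)) with h | h <;> linarith
  · right
    refine strand_genuine_dual c hδ hab hij hends fun t h1 h2 hlo hhi hnβ => ?_
    have hdom := cTgt_mem_edgeSet_of_isInnerFace (hinner t h1 h2.le)
    obtain ⟨hω | ⟨x, hx, hxB⟩, -⟩ := not_mem_bcBondConfig_cases hdom hnβ
    · exact hω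
    · exfalso
      have hd := dist_le_of_mem_cTgt hδ.le _ hx
      have h3 := dist_triangle (meshPoint F.δ x) (meshPoint F.δ (cornerOrbit (F.bcBondConfig ω) c t).1) z
      have h4 := dist_triangle (meshPoint F.δ (cornerOrbit (F.bcBondConfig ω) c t).1) (meshPoint F.δ x) z
      have h5 := dist_comm (meshPoint F.δ x) (meshPoint F.δ (cornerOrbit (F.bcBondConfig ω) c t).1)
      rcases hB x hxB with h | h <;> linarith

/-! ## The probabilistic consequence -/

/-- **One strand-crossing costs a genuine arm** (probabilistic form). Under the monochromatic-band
hypotheses for `E` and for `shiftData E w` around `z` (band `(a - 2δ, b + 2δ)`), the event of ONE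
strand-crossing of `A(z; a, b)` is contained in the union of the open crossing of `A(z; a, b)` and
the dual crossing of `A(z; a + 2δ, b - 2δ)` by `ω`, so its probability is at most the sum of
theirs. -/
theorem real_ufrsStrands_one_le_of_mono {E : DiscreteDobrushin} (hE : E.IsZdAdmissible) (w : Site 2)
    {z : ℂ} {a b : ℝ} (hab : a + 4 * E.δ < b)
    (hmonoE : (∀ x ∈ E.zdArcA, dist (meshPoint E.δ x) z ≤ a - 2 * E.δ ∨ b + 2 * E.δ ≤ dist (meshPoint E.δ x) z) ∨
      (∀ x ∈ E.zdArcB, dist (meshPoint E.δ x) z ≤ a - 2 * E.δ ∨ b + 2 * E.δ ≤ dist (meshPoint E.δ x) z))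
    (hmonoE' : (∀ x ∈ (shiftData E w).zdArcA, dist (meshPoint E.δ x) z ≤ a - 2 * E.δ ∨ b + 2 * E.δ ≤ dist (meshPoint E.δ x) z) ∨
      (∀ x ∈ (shiftData E w).zdArcB, dist (meshPoint E.δ x) z ≤ a - 2 * E.δ ∨ b + 2 * E.δ ≤ dist (meshPoint E.δ x) z)) :
    (bondPercolation (zdGraph 2) half).real (ufrsStrands E w z 1 a b) ≤
      (bondPercolation (zdGraph 2) half).real (annulusOpenCrossing z E.δ a b) +
        (bondPercolation (zdGraph 2) half).real (annulusDualCrossing z E.δ (a + 2 * E.δ) (b - 2 * E.δ)) := by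
  have hsub : ufrsStrands E w z 1 a b ⊆
      annulusOpenCrossing z E.δ a b ∪ annulusDualCrossing z E.δ (a + 2 * E.δ) (b - 2 * E.δ) := by
    intro ω hω
    rw [mem_ufrsStrands_iff] at hω
    obtain ⟨c, i, j, τ, hstr, -⟩ := hω
    obtain ⟨hij, hends, hinner, -⟩ := hstr 0
    cases hτ : τ 0
    · simp only [hτ, Bool.false_eq_true, ↓reduceIte] at hends hinner
      exact ufrs_strand_genuineCrossing (shiftData E w) (isZdAdmissible_shiftData E w hE) ω (c 0) (i 0) (j 0) z a b
        hij hab hends hinner hmonoE'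
    · simp only [hτ, ↓reduceIte] at hends hinner
      exact ufrs_strand_genuineCrossing E hE ω (c 0) (i 0) (j 0) z a b hij hab hends hinner hmonoE
  exact (measureReal_mono hsub (measure_ne_top _ _)).trans (measureReal_union_le _ _)

/-- **RSW for the two genuine crossings.** With the one-arm bounds for open and for dual annulus
crossings (the statements `annulusOpenCrossing_half_le`, `annulusDualCrossing_half_le` of the
tree, constants `α_o, c_o` and `α_d, c_d`), for `max c_o c_d · δ ≤ a`, `2δ ≤ a` and `16 a ≤ b` the
two probabilities of `real_ufrsStrands_one_le_of_mono` sum to at most `2 (4a/b)^{min α_o α_d}`. -/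
theorem real_open_add_dual_le {αo co αd cd δ a b : ℝ} {z : ℂ}
    (ho : ∀ (x : ℂ) (δ r R : ℝ), 0 < δ → co * δ ≤ r → 2 * r ≤ R →
      (bondPercolation (zdGraph 2) half).real (annulusOpenCrossing x δ r R) ≤ (r / R) ^ αo)
    (hd : ∀ (x : ℂ) (δ r R : ℝ), 0 < δ → cd * δ ≤ r → 2 * r ≤ R →
      (bondPercolation (zdGraph 2) half).real (annulusDualCrossing x δ r R) ≤ (r / R) ^ αd)
    (hαo : 0 < αo) (hαd : 0 < αd) (hδ : 0 < δ) (hco : co * δ ≤ a) (hcd : cd * δ ≤ a) (h2 : 2 * δ ≤ a)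
    (hab : 16 * a ≤ b) :
    (bondPercolation (zdGraph 2) half).real (annulusOpenCrossing z δ a b) +
      (bondPercolation (zdGraph 2) half).real (annulusDualCrossing z δ (a + 2 * δ) (b - 2 * δ)) ≤
      2 * (4 * (a / b)) ^ min αo αd := by
  have ha : 0 < a := by linarith
  have hb : 0 < b := by linarith
  have hx0 : 0 ≤ a / b := by positivity
  have hx1 : a / b ≤ 1 := by rw [div_le_one hb]; linarith
  have hx4 : a / b ≤ 4 * (a / b) := by linarith
  have hy0 : 0 ≤ (a + 2 * δ) / (b - 2 * δ) := div_nonneg (by linarith) (by linarith)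
  have hy1 : (a + 2 * δ) / (b - 2 * δ) ≤ 1 := by rw [div_le_one (by linarith)]; linarith
  have hy4 : (a + 2 * δ) / (b - 2 * δ) ≤ 4 * (a / b) :=
    calc (a + 2 * δ) / (b - 2 * δ) ≤ (2 * a) / (b - 2 * δ) :=
          div_le_div_of_nonneg_right (by linarith) (by linarith)
      _ ≤ (2 * a) / (b / 2) := div_le_div_of_nonneg_left (by linarith) (by linarith) (by linarith)
      _ = 4 * (a / b) := by field_simp; ring
  have hmin0 : 0 ≤ min αo αd := le_min hαo.le hαd.le
  have h40 : 0 ≤ 4 * (a / b) := by positivity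
  have h1 : (bondPercolation (zdGraph 2) half).real (annulusOpenCrossing z δ a b) ≤ (4 * (a / b)) ^ min αo αd :=
    calc (bondPercolation (zdGraph 2) half).real (annulusOpenCrossing z δ a b) ≤ (a / b) ^ αo :=
          ho z δ a b hδ hco (by linarith)
      _ ≤ (a / b) ^ min αo αd := Real.rpow_le_rpow_of_exponent_ge' hx0 hx1 hmin0 (min_le_left _ _)
      _ ≤ (4 * (a / b)) ^ min αo αd := Real.rpow_le_rpow hx0 hx4 hmin0
  have h3 : (bondPercolation (zdGraph 2) half).real (annulusDualCrossing z δ (a + 2 * δ) (b - 2 * δ)) ≤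
      (4 * (a / b)) ^ min αo αd :=
    calc (bondPercolation (zdGraph 2) half).real (annulusDualCrossing z δ (a + 2 * δ) (b - 2 * δ))
        ≤ ((a + 2 * δ) / (b - 2 * δ)) ^ αd := hd z δ (a + 2 * δ) (b - 2 * δ) hδ (by linarith) (by linarith)
      _ ≤ ((a + 2 * δ) / (b - 2 * δ)) ^ min αo αd :=
          Real.rpow_le_rpow_of_exponent_ge' hy0 hy1 hmin0 (min_le_right _ _)
      _ ≤ (4 * (a / b)) ^ min αo αd := Real.rpow_le_rpow hy0 hy4 hmin0
  linarith

end

end Summit.CriticalPhenomena.CardyFormulaZ2.Cruxes.EdgePrecompact.QkzStripBoundaryArm
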